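import Literature.Analysis.FluidPDE.NSLerayHopfABCTrajectory
import HarnessLib

/-!
# Albritton–Brué–Colombo 2022: Theorem 1.2 from a solution of the LINEARISED similarity system
  — the symmetric split `Ū ± ½W`, which bypasses the nonlinear instability (Thm. 1.3 (b) / Thm. 4.1)

Analysis/FluidPDE proofs-layer file (theorems and two unfolding definitions, no named facts) on
the proof line of the named fact `Literature.Analysis.FluidPDE.albritton_brue_colombo_unit`
(`NSLerayHopfABCScaling.lean`; Albritton–Brué–Colombo, Ann. of Math. 196 (2022) =
arXiv:2112.03116 [ABC], Thm. 1.2, faithful rendering) and of **ns.S20**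
`Literature.Analysis.FluidPDE.albritton_brue_colombo` (`NSLerayHopf.lean`), sequel of
`NSLerayHopfABCAssembly.lean` / `NSLerayHopfABCTrajectory.lean`. Those files reduce Thm. 1.2 to
TWO classical solutions of the similarity system [ABC] (1.9) with ONE force profile
(`albritton_brue_colombo_unit_of_similarityProfiles`), and bring that hypothesis to the shape of
[ABC] Thm. 1.3: a steady `Ū` plus ONE trajectory `U = Ū + U^{lin} + U^{per}` with the same force
`F̄` (`albritton_brue_colombo_of_unstableTrajectory`) — which needs both halves of Thm. 1.3,
(a) an unstable eigenvalue of `L_ss` (1.10) and (b) the trajectory on the unstable manifold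
(Thm. 4.1: semigroup bounds, fixed point, bootstrap, §4).

This file records and proves an elementary observation that **removes part (b) from the
decomposition**. Write `R(U) := ∂_τU − ½(U + DU·ξ) − ΔU + U·∇U` for the pressure-free residual
of (1.9) (`AlbrittonBrueColombo2022.similarityResidual`) and
`Lin_Ū(W) := ∂_τW − ½(W + DW·ξ) − ΔW + Ū·∇W + W·∇Ū` for its linearisation at `Ū`
(`AlbrittonBrueColombo2022.linearizedResidual`; with the Leray projector this is
`∂_τ W − L_ss W`, [ABC] (1.10)). Since `U ↦ U·∇U` is quadratic,

  `R(Ū + εW) = R(Ū) + ε Lin_Ū(W) + ε² W·∇W`   for every real `ε`,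

so if `(W, Q)` is a classical solution of the linearised system `Lin_Ū(W) + ∇Q = 0` then
`Ū + εW` with pressure `εQ` solves (1.9) with the force profile `R(Ū) + ε² W·∇W`
(`isSimilarityNSSolutionOn_add_smul_of_linearized`), which is **even in `ε`**: the two fields
`Ū + ½W`, `Ū − ½W` solve (1.9) with the SAME force `R(Ū) + ¼ W·∇W` (pressures `±½Q`) and differ
wherever `W ≠ 0`. Here `Ū` is an arbitrary smooth divergence-free profile path — it need not
solve anything, the force absorbs `R(Ū)` exactly as for the force profile `F̄` of [ABC] Thm. 1.3
("any smooth function of space may be considered a steady solution", §1.1) — and NO nonlinear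
problem has to be solved for the second solution. Feeding this pair into
`albritton_brue_colombo_unit_of_similarityProfiles` gives

* **`albritton_brue_colombo_unit_of_linearizedSolution`** — on `ℝ³`: a smooth divergence-free
  profile path `Ū` and a classical solution `(W, Q)` of the linearised system on the similarity
  times `τ < τ₁`, with the uniform `L² ∩ Ḣ¹ ∩ L³` bounds of the assembly on `Ū`, `W`, an `L²`
  bound on `Q` and on the force profile `R(Ū) + ¼W·∇W`, and `W(τ₀) ≢ 0` for some `τ₀ < τ₁`,
  give `albritton_brue_colombo_unit` (faithful rendering: jointly measurable force in
  `L¹(0,T; L²)`, two strict Leray–Hopf solutions from `u₀ = 0`, distinct at a positive time);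
* **`albritton_brue_colombo_unit_of_linearizedMode`** — the paper-shaped case `Ū ∈ C_c^∞(ℝ³;ℝ³)`
  steady (then `R(Ū) = F̄ = steadyForceProfile Ū`, Thm. 1.3): a bounded classical solution
  `(W, Q)` of `∂_τ W = L_ss W` on `τ < τ₁` with `W ∈ L^∞_τ(L² ∩ Ḣ¹ ∩ L³)`, `W·∇W ∈ L^∞_τ L²`,
  `Q ∈ L^∞_τ L²`, `W(τ₀) ≢ 0`, gives `albritton_brue_colombo_unit`, hence ns.S20
  (`albritton_brue_colombo_of_linearizedMode`). [ABC] Thm. 1.3 (a) delivers such data: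
  `W = U^{lin} = Re(e^{λτ}η)` (Thm. 1.3 (a): `L_ss η = λη`, `a = Re λ > 0`, `η ∈ H^k` for all `k`),
  bounded on `τ < τ₁` precisely because `Re λ ≥ 0`, with `∇Q = −(1 − P)(Ū·∇W + W·∇Ū)`,
  `Q = −Δ⁻¹ div div (Ū ⊗ W + W ⊗ Ū) ∈ L²` (Riesz transforms; `Ū ∈ L^∞`, `W ∈ L²`).

So what remains between the tree and `albritton_brue_colombo_unit_holds` is no longer Thm. 1.3
(a) + (b) but **Thm. 1.3 (a)-type LINEAR data alone** (indeed any bounded ancient classical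
solution of the linearised system at any bounded smooth profile path, unstable eigenvalue or
not): the spectral construction of [ABC] §§2–3 (Vishik's unstable vortex, its vortex-ring lift,
the Euler-to-Navier–Stokes perturbation Thm. 3.1 / Cor. 3.2) together with the classical
regularity of the eigenfunction. That part — spectral theory of a non-self-adjoint operator on
`L²_σ(ℝ³)` — is not in Mathlib or the tree and is NOT touched here; no fact is discharged.

## Remarks

* The identity behind the file is the polarisation `N(Ū+εW) − N(Ū−εW) = 2ε(Ū·∇W + W·∇Ū)` of the
  quadratic term `N(U) = U·∇U`; in physical variables it reads: if `w` solves the Navier–Stokes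
  equations linearised at ANY divergence-free `ū` (with pressure), then `ū ± ½w` solve the forced
  Navier–Stokes equations with the common force `(∂ₜ − νΔ)ū + ū·∇ū + ¼ w·∇w`. Non-uniqueness of
  the forced problem in a class is thus implied by non-uniqueness from zero data of a LINEARISED
  problem in that class; for bounded smooth `ū` the latter is excluded by the energy identity, and
  the self-similar `ū` of [ABC] (`‖∇ū(t)‖_∞ ∼ t⁻¹`) is exactly the borderline where it is not.
* The energy identity for the linearised similarity system,
  `½ d/dτ ‖W‖₂² = −¼‖W‖₂² − ‖∇W‖₂² − ⟪W·∇Ū, W⟫`, shows that a bounded solution on `τ → −∞`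
  forces `Ū` to carry strain of size `≥ ¼` for all very negative `τ`: there is no small-data or
  explicit shortcut to the remaining hypothesis (a remark; not formalised here).

## Tree / Mathlib search

Tree: `IsSimilarityNSSolutionOn`, `physVelocity` (`NSLerayHopfABCSimilarity`);
`albritton_brue_colombo_unit_of_similarityProfiles` (`NSLerayHopfABCAssembly`);
`steadyForceProfile`, `continuous_steadyForceProfile`, `hasCompactSupport_steadyForceProfile`,
`lintegral_enorm_add_sq_le`, `lintegral_enorm_add_cube_le`, `lintegral_frobeniusNormSq_add_le`,
`lintegral_enorm_sq_lt_top_of_hasCompactSupport`, `…_cube_…`, `lintegral_frobeniusNormSq_lt_top_…`,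
`continuous_frobeniusNormSq_fderiv'` (`NSLerayHopfABCTrajectory`); `IsSmoothSpaceTimeOn.add`,
`.const_smul`, `.differentiableWithinAt_time`, `.contDiff_slice` (`ClassicalSolution(Calculus)`);
`divergence_add_apply`, `divergence_const_smul_apply` (`PressurePoisson`); `gradient_const_smul`
(`NSViscosityRescaling`); `frobeniusNormSq_smul` (`SpaceTimeRescaling`);
`albritton_brue_colombo_of_unit` (`NSLerayHopfABCScaling`). Mathlib: `derivWithin_fun_add`,
`derivWithin_fun_const_smul` (no unique differentiability needed), `fderiv_fun_add`,
`fderiv_fun_const_smul`, `ContDiffAt.laplacian_add`, `laplacian_smul`, `module`.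
`lean search 'lineariz|Linearis|of_linearized'` in the ABC files: nothing prior.

## References

* D. Albritton, E. Brué, M. Colombo, *Non-uniqueness of Leray solutions of the forced
  Navier–Stokes equations*, Ann. of Math. 196 (2022) 415–455 = arXiv:2112.03116, §1.1
  (1.7)–(1.10), Thm. 1.2, Thm. 1.3 (a)–(b) with the force profile `F̄` and
  `U^{lin} = Re(e^{τλ}η)`, §4 (ansatz `U = Ū + U^{lin} + U^{per}`), Thm. 4.1. [AlbrittonBrueColombo2022]
-/

noncomputable section

open MeasureTheory TopologicalSpace Set Function Filter Topology InnerProductSpace Module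
open scoped RealInnerProductSpace NNReal ENNReal Laplacian ContDiff

namespace Literature.Analysis.FluidPDE

namespace AlbrittonBrueColombo2022

section General

variable {E : Type*} [NormedAddCommGroup E] [InnerProductSpace ℝ E] [FiniteDimensional ℝ E]

/-! ### The residual of (1.9) and its linearisation -/

/-- **The pressure-free residual of the similarity system (1.9)** of a profile path `U` on the
time set `S`: `R(U)(τ, ξ) := ∂_τU − ½(U + DU(ξ)ξ) − ΔU + DU(ξ)(U ξ)` (Albritton–Brué–Colombo
2022, (1.9) is `R(U) + ∇P = F`; for a steady `Ū` this is the force profile `F̄` of Thm. 1.3,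
`similarityResidual_const`). [cite: AlbrittonBrueColombo2022, §1.1 (1.9) and Thm. 1.3] -/
def similarityResidual (S : Set ℝ) (U : ℝ → E → E) (τ : ℝ) (ξ : E) : E :=
  timeDerivWithin S U τ ξ - (2⁻¹ : ℝ) • (U τ ξ + fderiv ℝ (U τ) ξ ξ) - (Δ (U τ)) ξ +
    convect (U τ) (U τ) ξ

/-- **The linearisation of (1.9) at a profile path `Ū`**, pressure-free:
`Lin_Ū(W)(τ, ξ) := ∂_τW − ½(W + DW(ξ)ξ) − ΔW + Ū·∇W + W·∇Ū` (Albritton–Brué–Colombo 2022,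
(1.10): with the Leray projector `P`, `−L_ss W = −½(1 + ξ·∇)W − ΔW + P(Ū·∇W + W·∇Ū)`, so the
linearised equation `∂_τW = L_ss W` of Thm. 1.3 (a) / §4 is `Lin_Ū(W) + ∇Q = 0` with
`∇Q = −(1 − P)(Ū·∇W + W·∇Ū)`). [cite: AlbrittonBrueColombo2022, §1.1 (1.10) and Thm. 1.3 (a)] -/
def linearizedResidual (S : Set ℝ) (Ubar W : ℝ → E → E) (τ : ℝ) (ξ : E) : E :=
  timeDerivWithin S W τ ξ - (2⁻¹ : ℝ) • (W τ ξ + fderiv ℝ (W τ) ξ ξ) - (Δ (W τ)) ξ +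
    (convect (Ubar τ) (W τ) ξ + convect (W τ) (Ubar τ) ξ)

/-- Unfolding `similarityResidual`. [cite: AlbrittonBrueColombo2022, §1.1 (1.9)] -/
theorem similarityResidual_apply (S : Set ℝ) (U : ℝ → E → E) (τ : ℝ) (ξ : E) :
    similarityResidual S U τ ξ =
      timeDerivWithin S U τ ξ - (2⁻¹ : ℝ) • (U τ ξ + fderiv ℝ (U τ) ξ ξ) - (Δ (U τ)) ξ +
        convect (U τ) (U τ) ξ := rfl

/-- Unfolding `linearizedResidual`. [cite: AlbrittonBrueColombo2022, §1.1 (1.10)] -/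
theorem linearizedResidual_apply (S : Set ℝ) (Ubar W : ℝ → E → E) (τ : ℝ) (ξ : E) :
    linearizedResidual S Ubar W τ ξ =
      timeDerivWithin S W τ ξ - (2⁻¹ : ℝ) • (W τ ξ + fderiv ℝ (W τ) ξ ξ) - (Δ (W τ)) ξ +
        (convect (Ubar τ) (W τ) ξ + convect (W τ) (Ubar τ) ξ) := rfl

/-- **(1.9) in residual form**: `(U, P)` solves the similarity system with force profile `F` on
`S` iff `U`, `P` are jointly smooth on `S × E`, `R(U) + ∇P = F` pointwise and `div U = 0`
(definitional repackaging of `IsSimilarityNSSolutionOn`). [cite: AlbrittonBrueColombo2022, §1.1 (1.9)] -/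
theorem isSimilarityNSSolutionOn_iff_residual {S : Set ℝ} {F U : ℝ → E → E} {P : ℝ → E → ℝ} :
    IsSimilarityNSSolutionOn S F U P ↔
      IsSmoothSpaceTimeOn S U ∧ IsSmoothSpaceTimeOn S P ∧
        (∀ τ ∈ S, ∀ ξ, similarityResidual S U τ ξ + gradient (P τ) ξ = F τ ξ) ∧
          ∀ τ ∈ S, VectorCalculus.IsDivFree (U τ) :=
  ⟨fun h => ⟨h.smooth_velocity, h.smooth_pressure, h.momentum, h.divFree⟩,
    fun h => ⟨h.1, h.2.1, h.2.2.1, h.2.2.2⟩⟩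

/-- **The residual of a steady profile is the force profile `F̄` of Thm. 1.3**: for `U(τ) = Ū`
independent of `τ`, `R(U)(τ, ξ) = F̄(ξ) = steadyForceProfile Ū ξ` on any time set (the time
derivative of a constant path vanishes). [cite: AlbrittonBrueColombo2022, Thm. 1.3 (force profile F̄)] -/
theorem similarityResidual_const (S : Set ℝ) (Ubar : E → E) (τ : ℝ) (ξ : E) :
    similarityResidual S (fun _ => Ubar) τ ξ = steadyForceProfile Ubar ξ := by
  have h1 : timeDerivWithin S (fun _ : ℝ => Ubar) τ ξ = 0 := by
    simp only [timeDerivWithin_apply, derivWithin_fun_const, Pi.zero_apply]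
  rw [similarityResidual_apply, steadyForceProfile_apply, h1, zero_sub]

/-! ### The symmetric split -/

variable {S : Set ℝ} {Ubar W : ℝ → E → E} {Q : ℝ → E → ℝ}

/-- **Expansion of the residual along a line of profiles**: for jointly smooth `Ū`, `W` on the
time set `S` and every real `ε`,
`R(Ū + εW) = R(Ū) + ε Lin_Ū(W) + ε² W·∇W` pointwise on `S × E` — the residual of (1.9) is the sum
of a part linear in `U` and the quadratic `U·∇U`, whose polarisation is the linearisation (1.10)
(Albritton–Brué–Colombo 2022, (1.9)–(1.10); elementary). [cite: AlbrittonBrueColombo2022, §1.1 (1.9)–(1.10)] -/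
theorem similarityResidual_add_smul (hU : IsSmoothSpaceTimeOn S Ubar) (hW : IsSmoothSpaceTimeOn S W)
    (ε : ℝ) {τ : ℝ} (hτ : τ ∈ S) (ξ : E) :
    similarityResidual S (fun σ ζ => Ubar σ ζ + ε • W σ ζ) τ ξ =
      similarityResidual S Ubar τ ξ + ε • linearizedResidual S Ubar W τ ξ +
        (ε ^ 2) • convect (W τ) (W τ) ξ := by
  -- differentiability of the slices and of the time lines
  have hUd : DifferentiableAt ℝ (Ubar τ) ξ :=
    ((hU.contDiff_slice hτ).differentiable (by simp)).differentiableAt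
  have hWd : DifferentiableAt ℝ (W τ) ξ :=
    ((hW.contDiff_slice hτ).differentiable (by simp)).differentiableAt
  have hU2 : ContDiffAt ℝ 2 (Ubar τ) ξ := ((hU.contDiff_slice hτ).of_le (by norm_cast)).contDiffAt
  have hW2 : ContDiffAt ℝ 2 (W τ) ξ := ((hW.contDiff_slice hτ).of_le (by norm_cast)).contDiffAt
  have hUt : DifferentiableWithinAt ℝ (fun σ => Ubar σ ξ) S τ := hU.differentiableWithinAt_time hτ ξ
  have hWt : DifferentiableWithinAt ℝ (fun σ => W σ ξ) S τ := hW.differentiableWithinAt_time hτ ξ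
  have hWt' : DifferentiableWithinAt ℝ (fun σ => ε • W σ ξ) S τ := hWt.fun_const_smul ε
  have hWd' : DifferentiableAt ℝ (fun ζ => ε • W τ ζ) ξ := hWd.fun_const_smul ε
  -- the time derivative
  have ht : timeDerivWithin S (fun σ ζ => Ubar σ ζ + ε • W σ ζ) τ ξ =
      timeDerivWithin S Ubar τ ξ + ε • timeDerivWithin S W τ ξ := by
    simp only [timeDerivWithin_apply]
    rw [derivWithin_fun_add hUt hWt', derivWithin_fun_const_smul ε hWt]
  -- the space derivative
  have hD : ∀ v, fderiv ℝ (fun ζ => Ubar τ ζ + ε • W τ ζ) ξ v =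
      fderiv ℝ (Ubar τ) ξ v + ε • fderiv ℝ (W τ) ξ v := fun v => by
    rw [fderiv_fun_add hUd hWd', fderiv_fun_const_smul hWd]
    rfl
  -- the Laplacian
  have hL : (Δ (fun ζ => Ubar τ ζ + ε • W τ ζ)) ξ = (Δ (Ubar τ)) ξ + ε • (Δ (W τ)) ξ := by
    have e1 : (fun ζ => Ubar τ ζ + ε • W τ ζ) = Ubar τ + fun ζ => ε • W τ ζ := rfl
    have e2 : (fun ζ => ε • W τ ζ) = ε • W τ := rfl
    rw [e1, ContDiffAt.laplacian_add hU2 (hW2.const_smul ε), e2, laplacian_smul ε hW2]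
  -- assemble
  simp only [similarityResidual_apply, linearizedResidual_apply, convect_apply, ht, hD, hL,
    map_add, map_smul]
  module

/-- **The symmetric split (similarity variables).** Let `Ū`, `W`, `Q` be jointly smooth on the
time set `S`, `Ū(τ)` and `W(τ)` divergence free, and let `(W, Q)` solve the similarity system
(1.9) LINEARISED at `Ū`, `Lin_Ū(W) + ∇Q = 0` on `S × E` (i.e. `∂_τW = L_ss W`, (1.10) and
Thm. 1.3 (a), written with its pressure). Then for every real `ε` the profile path `Ū + εW` with
pressure `εQ` is a classical solution of (1.9) on `S` with the force profile `R(Ū) + ε² W·∇W`,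
which does not see the sign of `ε` (`similarityResidual_add_smul`; Albritton–Brué–Colombo
2022, (1.9)–(1.10) and §1.1: "any smooth function of space may be considered a steady solution"
— here any smooth path, the force absorbing `R(Ū)`).
[cite: AlbrittonBrueColombo2022, §1.1 (1.9)–(1.10) and Thm. 1.3] -/
theorem isSimilarityNSSolutionOn_add_smul_of_linearized (hU : IsSmoothSpaceTimeOn S Ubar)
    (hW : IsSmoothSpaceTimeOn S W) (hQ : IsSmoothSpaceTimeOn S Q)
    (hUdiv : ∀ τ ∈ S, VectorCalculus.IsDivFree (Ubar τ))
    (hWdiv : ∀ τ ∈ S, VectorCalculus.IsDivFree (W τ))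
    (hlin : ∀ τ ∈ S, ∀ ξ, linearizedResidual S Ubar W τ ξ + gradient (Q τ) ξ = 0) (ε : ℝ) :
    IsSimilarityNSSolutionOn S
      (fun τ ξ => similarityResidual S Ubar τ ξ + (ε ^ 2) • convect (W τ) (W τ) ξ)
      (fun τ ξ => Ubar τ ξ + ε • W τ ξ) (fun τ ξ => ε * Q τ ξ) := by
  refine isSimilarityNSSolutionOn_iff_residual.2 ⟨hU.add (hW.const_smul ε), hQ.const_smul ε,
    fun τ hτ ξ => ?_, fun τ hτ ξ => ?_⟩
  · -- momentum: `R(Ū + εW) + ε∇Q = R(Ū) + ε (Lin W + ∇Q) + ε² W·∇W`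
    have hQd : DifferentiableAt ℝ (Q τ) ξ :=
      ((hQ.contDiff_slice hτ).differentiable (by simp)).differentiableAt
    have hG : gradient (fun ζ => ε * Q τ ζ) ξ = ε • gradient (Q τ) ξ := gradient_const_smul hQd ε
    rw [similarityResidual_add_smul hU hW ε hτ ξ, hG]
    have key : similarityResidual S Ubar τ ξ + ε • linearizedResidual S Ubar W τ ξ +
        (ε ^ 2) • convect (W τ) (W τ) ξ + ε • gradient (Q τ) ξ =
        similarityResidual S Ubar τ ξ + (ε ^ 2) • convect (W τ) (W τ) ξ +
          ε • (linearizedResidual S Ubar W τ ξ + gradient (Q τ) ξ) := by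
      module
    rw [key, hlin τ hτ ξ, smul_zero, add_zero]
  · -- incompressibility
    have hUd : DifferentiableAt ℝ (Ubar τ) ξ :=
      ((hU.contDiff_slice hτ).differentiable (by simp)).differentiableAt
    have hWd : DifferentiableAt ℝ (W τ) ξ :=
      ((hW.contDiff_slice hτ).differentiable (by simp)).differentiableAt
    have hWd' : DifferentiableAt ℝ (fun ζ => ε • W τ ζ) ξ := hWd.fun_const_smul ε
    rw [divergence_add_apply hUd hWd', divergence_const_smul_apply hWd,
      hUdiv τ hτ ξ, hWdiv τ hτ ξ, mul_zero, add_zero]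

/-- **Two solutions of (1.9) with one force from one solution of the linearised system**: under
the hypotheses of `isSimilarityNSSolutionOn_add_smul_of_linearized`, `Ū + ½W` (pressure `½Q`)
and `Ū − ½W` (pressure `−½Q`) are classical solutions of (1.9) on `S` with the SAME force profile
`R(Ū) + ¼ W·∇W`. [cite: AlbrittonBrueColombo2022, §1.1 (1.9)–(1.10) and Thm. 1.3] -/
theorem isSimilarityNSSolutionOn_pair_of_linearized (hU : IsSmoothSpaceTimeOn S Ubar)
    (hW : IsSmoothSpaceTimeOn S W) (hQ : IsSmoothSpaceTimeOn S Q)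
    (hUdiv : ∀ τ ∈ S, VectorCalculus.IsDivFree (Ubar τ))
    (hWdiv : ∀ τ ∈ S, VectorCalculus.IsDivFree (W τ))
    (hlin : ∀ τ ∈ S, ∀ ξ, linearizedResidual S Ubar W τ ξ + gradient (Q τ) ξ = 0) :
    IsSimilarityNSSolutionOn S
        (fun τ ξ => similarityResidual S Ubar τ ξ + (4⁻¹ : ℝ) • convect (W τ) (W τ) ξ)
        (fun τ ξ => Ubar τ ξ + (2⁻¹ : ℝ) • W τ ξ) (fun τ ξ => 2⁻¹ * Q τ ξ) ∧
      IsSimilarityNSSolutionOn S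
        (fun τ ξ => similarityResidual S Ubar τ ξ + (4⁻¹ : ℝ) • convect (W τ) (W τ) ξ)
        (fun τ ξ => Ubar τ ξ + (-2⁻¹ : ℝ) • W τ ξ) (fun τ ξ => (-2⁻¹) * Q τ ξ) := by
  have h4 : ((2⁻¹ : ℝ)) ^ 2 = 4⁻¹ := by norm_num
  have h4' : ((-2⁻¹ : ℝ)) ^ 2 = 4⁻¹ := by norm_num
  have hp := isSimilarityNSSolutionOn_add_smul_of_linearized hU hW hQ hUdiv hWdiv hlin (2⁻¹ : ℝ)
  have hm := isSimilarityNSSolutionOn_add_smul_of_linearized hU hW hQ hUdiv hWdiv hlin (-2⁻¹ : ℝ)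
  rw [h4] at hp
  rw [h4'] at hm
  exact ⟨hp, hm⟩

end General

/-! ### Bounds for `Ū + εW` on `ℝ³`, `|ε| ≤ 1` -/

section Bounds

variable {Ubar W : ℝ → EuclideanSpace ℝ (Fin 3) → EuclideanSpace ℝ (Fin 3)} {τ ε : ℝ}

/-- `∫|Ū + εW|² ≤ 2∫|Ū|² + 2∫|W|²` for `|ε| ≤ 1`. [folklore] -/
theorem lintegral_enorm_sq_add_smul_le (hUm : AEMeasurable (fun ξ => ‖Ubar τ ξ‖ₑ) volume)
    (hε : |ε| ≤ 1) :
    ∫⁻ ξ, ‖Ubar τ ξ + ε • W τ ξ‖ₑ ^ 2 ≤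
      (2 * ∫⁻ ξ, ‖Ubar τ ξ‖ₑ ^ 2) + 2 * ∫⁻ ξ, ‖W τ ξ‖ₑ ^ 2 := by
  refine (lintegral_enorm_add_sq_le hUm _).trans ?_
  gcongr with ξ
  rw [enorm_smul]
  calc ‖ε‖ₑ * ‖W τ ξ‖ₑ ≤ 1 * ‖W τ ξ‖ₑ := by
        gcongr
        rw [Real.enorm_eq_ofReal_abs]
        exact ENNReal.ofReal_le_one.2 hε
    _ = ‖W τ ξ‖ₑ := one_mul _

/-- `∫|Ū + εW|³ ≤ 4∫|Ū|³ + 4∫|W|³` for `|ε| ≤ 1`. [folklore] -/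
theorem lintegral_enorm_cube_add_smul_le (hUm : AEMeasurable (fun ξ => ‖Ubar τ ξ‖ₑ) volume)
    (hε : |ε| ≤ 1) :
    ∫⁻ ξ, ‖Ubar τ ξ + ε • W τ ξ‖ₑ ^ (3 : ℕ) ≤
      (4 * ∫⁻ ξ, ‖Ubar τ ξ‖ₑ ^ (3 : ℕ)) + 4 * ∫⁻ ξ, ‖W τ ξ‖ₑ ^ (3 : ℕ) := by
  refine (lintegral_enorm_add_cube_le hUm _).trans ?_
  gcongr with ξ
  rw [enorm_smul]
  calc ‖ε‖ₑ * ‖W τ ξ‖ₑ ≤ 1 * ‖W τ ξ‖ₑ := by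
        gcongr
        rw [Real.enorm_eq_ofReal_abs]
        exact ENNReal.ofReal_le_one.2 hε
    _ = ‖W τ ξ‖ₑ := one_mul _

/-- `∫|∇(Ū + εW)|² ≤ 2∫|∇Ū|² + 2∫|∇W|²` for `|ε| ≤ 1` and differentiable slices. [folklore] -/
theorem lintegral_frobeniusNormSq_fderiv_add_smul_le
    (hUd : Differentiable ℝ (Ubar τ)) (hWd : Differentiable ℝ (W τ))
    (hDUm : AEMeasurable (fun ξ => ENNReal.ofReal (frobeniusNormSq (fderiv ℝ (Ubar τ) ξ))) volume)
    (hε : |ε| ≤ 1) :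
    ∫⁻ ξ, ENNReal.ofReal (frobeniusNormSq (fderiv ℝ (fun ζ => Ubar τ ζ + ε • W τ ζ) ξ)) ≤
      (2 * ∫⁻ ξ, ENNReal.ofReal (frobeniusNormSq (fderiv ℝ (Ubar τ) ξ))) +
        2 * ∫⁻ ξ, ENNReal.ofReal (frobeniusNormSq (fderiv ℝ (W τ) ξ)) := by
  have hD : ∀ ξ, fderiv ℝ (fun ζ => Ubar τ ζ + ε • W τ ζ) ξ =
      fderiv ℝ (Ubar τ) ξ + ε • fderiv ℝ (W τ) ξ := fun ξ => by
    rw [fderiv_fun_add (hUd ξ) ((hWd ξ).fun_const_smul ε), fderiv_fun_const_smul (hWd ξ)]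
  calc ∫⁻ ξ, ENNReal.ofReal (frobeniusNormSq (fderiv ℝ (fun ζ => Ubar τ ζ + ε • W τ ζ) ξ))
      = ∫⁻ ξ, ENNReal.ofReal (frobeniusNormSq (fderiv ℝ (Ubar τ) ξ + ε • fderiv ℝ (W τ) ξ)) :=
        lintegral_congr fun ξ => by rw [hD ξ]
    _ ≤ (2 * ∫⁻ ξ, ENNReal.ofReal (frobeniusNormSq (fderiv ℝ (Ubar τ) ξ))) +
          2 * ∫⁻ ξ, ENNReal.ofReal (frobeniusNormSq (ε • fderiv ℝ (W τ) ξ)) :=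
        lintegral_frobeniusNormSq_add_le hDUm _
    _ ≤ (2 * ∫⁻ ξ, ENNReal.ofReal (frobeniusNormSq (fderiv ℝ (Ubar τ) ξ))) +
          2 * ∫⁻ ξ, ENNReal.ofReal (frobeniusNormSq (fderiv ℝ (W τ) ξ)) := by
        gcongr with ξ
        rw [frobeniusNormSq_smul]
        have h0 := frobeniusNormSq_nonneg (fderiv ℝ (W τ) ξ)
        have h1 : ε ^ 2 ≤ 1 := by
          rw [← sq_abs]
          exact pow_le_one₀ (abs_nonneg ε) hε
        nlinarith

/-- `∫|ε Q|² ≤ ∫|Q|²` for `|ε| ≤ 1`. [folklore] -/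
theorem lintegral_enorm_sq_const_mul_le {Q : ℝ → EuclideanSpace ℝ (Fin 3) → ℝ} (hε : |ε| ≤ 1) :
    ∫⁻ ξ, ‖ε * Q τ ξ‖ₑ ^ 2 ≤ ∫⁻ ξ, ‖Q τ ξ‖ₑ ^ 2 := by
  refine lintegral_mono fun ξ => ?_
  gcongr
  rw [enorm_mul]
  calc ‖ε‖ₑ * ‖Q τ ξ‖ₑ ≤ 1 * ‖Q τ ξ‖ₑ := by
        gcongr
        rw [Real.enorm_eq_ofReal_abs]
        exact ENNReal.ofReal_le_one.2 hε
    _ = ‖Q τ ξ‖ₑ := one_mul _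

end Bounds

end AlbrittonBrueColombo2022

/-! ### Theorem 1.2 from a solution of the linearised system -/

section Final

open AlbrittonBrueColombo2022

/-- **Albritton–Brué–Colombo 2022, Thm. 1.2 (faithful rendering) from a classical solution of the
LINEARISED similarity system — no nonlinear instability needed.** Let `Ū` be a jointly smooth
divergence-free profile path on the similarity times `τ < τ₁` (it need not solve anything), and
let `(W, Q)` be a classical solution there of (1.9) linearised at `Ū`,
`∂_τW − ½(W + DW·ξ) − ΔW + Ū·∇W + W·∇Ū + ∇Q = 0`, `div W = 0` (i.e. `∂_τ W = L_ss W`, (1.10)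
and Thm. 1.3 (a), with its pressure), such that, uniformly in `τ < τ₁`, `Ū(τ)` and `W(τ)` are
bounded in `L² ∩ Ḣ¹ ∩ L³`, `Q(τ)` in `L²`, the force profile `R(Ū) + ¼ W·∇W` in `L²`, and
`W(τ₀) ≢ 0` (not a.e. zero) for some `τ₀ < τ₁`. Then `albritton_brue_colombo_unit` holds: by the symmetric split
(`isSimilarityNSSolutionOn_pair_of_linearized`) `U₊ = Ū + ½W` and `U₋ = Ū − ½W` are two classical
solutions of (1.9) with the one force profile `F = R(Ū) + ¼ W·∇W` (pressures `±½Q`), they inherit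
the uniform bounds (`(x+y)² ≤ 2x²+2y²`, `(x+y)³ ≤ 4(x³+y³)`), and `U₊(τ₀) − U₋(τ₀) = W(τ₀) ≢ 0`;
conclude by `albritton_brue_colombo_unit_of_similarityProfiles` (two strict Leray–Hopf solutions
`physVelocity U_±` on `ℝ³ × [0, T]` from `u₀ = 0` with the jointly measurable force
`physForce F ∈ L¹(0,T;L²)`, distinct at `e^{τ₀}`). In the paper the second solution is instead
`Ū + U^{lin} + U^{per}` with `U^{per}` from the nonlinear instability argument (Thm. 1.3 (b) =
Thm. 4.1, §4); the present route needs only the linear data. What is NOT proved here is the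
existence of such `(Ū, W, Q)` — for `Ū` the truncated Vishik vortex ring this is Thm. 1.3 (a)
(§§2–3), the analytic core of the paper. [cite: AlbrittonBrueColombo2022, Thm. 1.3 (a) and (1.9)–(1.10) ⟹ Thm. 1.2] -/
theorem albritton_brue_colombo_unit_of_linearizedSolution {τ₁ : ℝ}
    {Ubar W : ℝ → EuclideanSpace ℝ (Fin 3) → EuclideanSpace ℝ (Fin 3)}
    {Q : ℝ → EuclideanSpace ℝ (Fin 3) → ℝ}
    (hU : IsSmoothSpaceTimeOn (Iio τ₁) Ubar) (hW : IsSmoothSpaceTimeOn (Iio τ₁) W)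
    (hQ : IsSmoothSpaceTimeOn (Iio τ₁) Q)
    (hUdiv : ∀ τ < τ₁, VectorCalculus.IsDivFree (Ubar τ))
    (hWdiv : ∀ τ < τ₁, VectorCalculus.IsDivFree (W τ))
    (hlin : ∀ τ < τ₁, ∀ ξ, linearizedResidual (Iio τ₁) Ubar W τ ξ + gradient (Q τ) ξ = 0)
    {M : ℝ≥0∞} (hM : M ≠ ⊤)
    (hU2 : ∀ τ < τ₁, ∫⁻ ξ, ‖Ubar τ ξ‖ₑ ^ 2 ≤ M) (hW2 : ∀ τ < τ₁, ∫⁻ ξ, ‖W τ ξ‖ₑ ^ 2 ≤ M)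
    (hDU : ∀ τ < τ₁, ∫⁻ ξ, ENNReal.ofReal (frobeniusNormSq (fderiv ℝ (Ubar τ) ξ)) ≤ M)
    (hDW : ∀ τ < τ₁, ∫⁻ ξ, ENNReal.ofReal (frobeniusNormSq (fderiv ℝ (W τ) ξ)) ≤ M)
    (hU3 : ∀ τ < τ₁, ∫⁻ ξ, ‖Ubar τ ξ‖ₑ ^ (3 : ℕ) ≤ M)
    (hW3 : ∀ τ < τ₁, ∫⁻ ξ, ‖W τ ξ‖ₑ ^ (3 : ℕ) ≤ M)
    (hQ2 : ∀ τ < τ₁, ∫⁻ ξ, ‖Q τ ξ‖ₑ ^ 2 ≤ M)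
    (hF2 : ∀ τ < τ₁, ∫⁻ ξ, ‖similarityResidual (Iio τ₁) Ubar τ ξ +
      (4⁻¹ : ℝ) • convect (W τ) (W τ) ξ‖ₑ ^ 2 ≤ M)
    (hne : ∃ τ₀ < τ₁, ¬ (W τ₀ =ᵐ[volume] 0)) :
    albritton_brue_colombo_unit := by
  obtain ⟨hp, hm⟩ := isSimilarityNSSolutionOn_pair_of_linearized hU hW hQ
    (fun τ hτ => hUdiv τ hτ) (fun τ hτ => hWdiv τ hτ) (fun τ hτ => hlin τ hτ)
  -- the common constant
  set M' : ℝ≥0∞ := 8 * M with hM'_def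
  have hM't : M' ≠ ⊤ := ENNReal.mul_ne_top (by norm_num) hM
  have hMM' : M ≤ M' := by
    rw [hM'_def]
    calc M = 1 * M := (one_mul _).symm
      _ ≤ 8 * M := by gcongr; norm_num
  have h22 : 2 * M + 2 * M ≤ M' := by
    rw [hM'_def, ← add_mul]
    gcongr
    norm_num
  have h44 : 4 * M + 4 * M ≤ M' := by
    rw [hM'_def, ← add_mul]
    gcongr
    norm_num
  have hεp : |(2⁻¹ : ℝ)| ≤ 1 := by norm_num
  have hεm : |(-2⁻¹ : ℝ)| ≤ 1 := by norm_num
  -- measurability and differentiability of the slices of `Ū`, `W`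
  have hUm : ∀ τ < τ₁, AEMeasurable (fun ξ => ‖Ubar τ ξ‖ₑ)
      (volume : Measure (EuclideanSpace ℝ (Fin 3))) := fun τ hτ =>
    (hU.contDiff_slice hτ).continuous.aemeasurable.enorm
  have hUd : ∀ τ < τ₁, Differentiable ℝ (Ubar τ) := fun τ hτ =>
    (hU.contDiff_slice hτ).differentiable (by simp)
  have hWd : ∀ τ < τ₁, Differentiable ℝ (W τ) := fun τ hτ =>
    (hW.contDiff_slice hτ).differentiable (by simp)
  have hDUm : ∀ τ < τ₁,
      AEMeasurable (fun ξ => ENNReal.ofReal (frobeniusNormSq (fderiv ℝ (Ubar τ) ξ)))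
        (volume : Measure (EuclideanSpace ℝ (Fin 3))) := fun τ hτ =>
    (continuous_frobeniusNormSq_fderiv'
      ((hU.contDiff_slice hτ).of_le (by norm_cast))).aemeasurable.ennreal_ofReal
  refine albritton_brue_colombo_unit_of_similarityProfiles hM't hp hm
    (fun τ hτ => ⟨((lintegral_enorm_sq_add_smul_le (hUm τ hτ) hεp).trans
        (by gcongr <;> first | exact hU2 τ hτ | exact hW2 τ hτ)).trans h22,
      ((lintegral_enorm_sq_add_smul_le (hUm τ hτ) hεm).trans
        (by gcongr <;> first | exact hU2 τ hτ | exact hW2 τ hτ)).trans h22⟩)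
    (fun τ hτ => ⟨((lintegral_frobeniusNormSq_fderiv_add_smul_le (hUd τ hτ) (hWd τ hτ) (hDUm τ hτ)
        hεp).trans (by gcongr <;> first | exact hDU τ hτ | exact hDW τ hτ)).trans h22,
      ((lintegral_frobeniusNormSq_fderiv_add_smul_le (hUd τ hτ) (hWd τ hτ) (hDUm τ hτ)
        hεm).trans (by gcongr <;> first | exact hDU τ hτ | exact hDW τ hτ)).trans h22⟩)
    (fun τ hτ => ⟨((lintegral_enorm_cube_add_smul_le (hUm τ hτ) hεp).trans
        (by gcongr <;> first | exact hU3 τ hτ | exact hW3 τ hτ)).trans h44,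
      ((lintegral_enorm_cube_add_smul_le (hUm τ hτ) hεm).trans
        (by gcongr <;> first | exact hU3 τ hτ | exact hW3 τ hτ)).trans h44⟩)
    (fun τ hτ => ⟨((lintegral_enorm_sq_const_mul_le hεp).trans (hQ2 τ hτ)).trans hMM',
      ((lintegral_enorm_sq_const_mul_le hεm).trans (hQ2 τ hτ)).trans hMM'⟩)
    (fun τ hτ => (hF2 τ hτ).trans hMM') ?_
  -- distinctness at `τ₀`: `U₊(τ₀) − U₋(τ₀) = W(τ₀)`
  obtain ⟨τ₀, hτ₀, hne⟩ := hne
  refine ⟨τ₀, hτ₀, fun hae => hne ?_⟩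
  filter_upwards [hae] with ξ hξ
  have h1 : (2⁻¹ : ℝ) • W τ₀ ξ = (-2⁻¹ : ℝ) • W τ₀ ξ := add_left_cancel hξ
  have h2 : ((2⁻¹ : ℝ) - (-2⁻¹ : ℝ)) • W τ₀ ξ = 0 := by rw [sub_smul, h1, sub_self]
  norm_num at h2
  exact h2

/-- **Albritton–Brué–Colombo 2022, Thm. 1.2 from Thm. 1.3 (a)-type data — the paper-shaped form of
the remaining hypothesis.** Let `Ū ∈ C_c^∞(ℝ³; ℝ³)` be divergence free (the background; its
residual is the force profile `F̄ = steadyForceProfile Ū` of Thm. 1.3), and let `(W, Q)` be a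
classical solution of the linearised equation `∂_τ W = L_ss W` ((1.10), Thm. 1.3 (a); here with
its pressure: `∂_τW − ½(W + DW·ξ) − ΔW + Ū·∇W + W·∇Ū + ∇Q = 0`, `div W = 0`) on the similarity
times `τ < τ₁`, bounded there in the sense `sup_τ (‖W‖₂² + ‖∇W‖₂² + ‖W‖₃³ + ‖W·∇W‖₂² + ‖Q‖₂²) < ∞`,
with `W(τ₀) ≢ 0` for some `τ₀ < τ₁`. Then `albritton_brue_colombo_unit` holds
(`albritton_brue_colombo_unit_of_linearizedSolution` with the constant path `Ū`; the finiteness of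
the norms of the compactly supported smooth `Ū`, `F̄` supplies the remaining bounds). Thm. 1.3 (a)
of the paper provides such data: `W = U^{lin} = Re(e^{λτ}η)` with `L_ss η = λη`,
`a = Re λ > 0`, `η ∈ H^k(ℝ³)` for all `k` (Thm. 1.3 (a): "a solution of the linearized equation
`∂_τ U^{lin} = L_ss U^{lin}` in `ℝ³ × ℝ`"), bounded on `τ < τ₁` since `Re λ ≥ 0`, and
`Q = −Δ⁻¹ div div(Ū ⊗ W + W ⊗ Ū)`; the nonlinear part (b) of Thm. 1.3 (Thm. 4.1) is not needed.
NOT proved here: the existence of `(Ū, λ, η)` — Vishik's unstable vortex and its ring lift (§2)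
and the Euler-to-Navier–Stokes spectral perturbation (Thm. 3.1 / Cor. 3.2). [cite: AlbrittonBrueColombo2022, Thm. 1.3 (a) and (1.10) ⟹ Thm. 1.2] -/
theorem albritton_brue_colombo_unit_of_linearizedMode
    {Ubar : EuclideanSpace ℝ (Fin 3) → EuclideanSpace ℝ (Fin 3)} (hUs : ContDiff ℝ ∞ Ubar)
    (hUc : HasCompactSupport Ubar) (hUdiv : VectorCalculus.IsDivFree Ubar) {τ₁ : ℝ}
    {W : ℝ → EuclideanSpace ℝ (Fin 3) → EuclideanSpace ℝ (Fin 3)}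
    {Q : ℝ → EuclideanSpace ℝ (Fin 3) → ℝ}
    (hW : IsSmoothSpaceTimeOn (Iio τ₁) W) (hQ : IsSmoothSpaceTimeOn (Iio τ₁) Q)
    (hWdiv : ∀ τ < τ₁, VectorCalculus.IsDivFree (W τ))
    (hlin : ∀ τ < τ₁, ∀ ξ,
      linearizedResidual (Iio τ₁) (fun _ => Ubar) W τ ξ + gradient (Q τ) ξ = 0)
    {M : ℝ≥0∞} (hM : M ≠ ⊤) (hW2 : ∀ τ < τ₁, ∫⁻ ξ, ‖W τ ξ‖ₑ ^ 2 ≤ M)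
    (hDW : ∀ τ < τ₁, ∫⁻ ξ, ENNReal.ofReal (frobeniusNormSq (fderiv ℝ (W τ) ξ)) ≤ M)
    (hW3 : ∀ τ < τ₁, ∫⁻ ξ, ‖W τ ξ‖ₑ ^ (3 : ℕ) ≤ M)
    (hWW : ∀ τ < τ₁, ∫⁻ ξ, ‖convect (W τ) (W τ) ξ‖ₑ ^ 2 ≤ M)
    (hQ2 : ∀ τ < τ₁, ∫⁻ ξ, ‖Q τ ξ‖ₑ ^ 2 ≤ M)
    (hne : ∃ τ₀ < τ₁, ¬ (W τ₀ =ᵐ[volume] 0)) :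
    albritton_brue_colombo_unit := by
  have hUcont : Continuous Ubar := hUs.continuous
  have hU1 : ContDiff ℝ 1 Ubar := hUs.of_le (by norm_cast)
  have hU3 : ContDiff ℝ 3 Ubar := hUs.of_le (by norm_cast)
  -- the constant path is jointly smooth
  have hU : IsSmoothSpaceTimeOn (Iio τ₁) (fun _ : ℝ => Ubar) := by
    change ContDiffOn ℝ ∞ (fun z : ℝ × EuclideanSpace ℝ (Fin 3) => Ubar z.2) (Iio τ₁ ×ˢ univ)
    exact (hUs.comp contDiff_snd).contDiffOn
  -- the finite norms of `Ū` and `F̄`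
  have hFc : Continuous (steadyForceProfile Ubar) := continuous_steadyForceProfile hU3
  have hFs : HasCompactSupport (steadyForceProfile Ubar) := hasCompactSupport_steadyForceProfile hUc
  set K : ℝ≥0∞ := (∫⁻ ξ, ‖Ubar ξ‖ₑ ^ 2) +
      (∫⁻ ξ, ENNReal.ofReal (frobeniusNormSq (fderiv ℝ Ubar ξ))) +
      (∫⁻ ξ, ‖Ubar ξ‖ₑ ^ (3 : ℕ)) + ∫⁻ ξ, ‖steadyForceProfile Ubar ξ‖ₑ ^ 2 with hK_def
  have hKt : K ≠ ⊤ := by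
    rw [hK_def]
    exact (ENNReal.add_lt_top.2 ⟨ENNReal.add_lt_top.2 ⟨ENNReal.add_lt_top.2
      ⟨lintegral_enorm_sq_lt_top_of_hasCompactSupport hUcont hUc,
        lintegral_frobeniusNormSq_lt_top_of_hasCompactSupport hU1 hUc⟩,
      lintegral_enorm_cube_lt_top_of_hasCompactSupport hUcont hUc⟩,
      lintegral_enorm_sq_lt_top_of_hasCompactSupport hFc hFs⟩).ne
  have hK1 : ∫⁻ ξ, ‖Ubar ξ‖ₑ ^ 2 ≤ K := by
    rw [hK_def]; exact le_add_right (le_add_right (le_add_right le_rfl))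
  have hK2 : ∫⁻ ξ, ENNReal.ofReal (frobeniusNormSq (fderiv ℝ Ubar ξ)) ≤ K := by
    rw [hK_def]; exact le_add_right (le_add_right (le_add_left le_rfl))
  have hK3 : ∫⁻ ξ, ‖Ubar ξ‖ₑ ^ (3 : ℕ) ≤ K := by
    rw [hK_def]; exact le_add_right (le_add_left le_rfl)
  have hK4 : ∫⁻ ξ, ‖steadyForceProfile Ubar ξ‖ₑ ^ 2 ≤ K := by
    rw [hK_def]; exact le_add_left le_rfl
  -- the common constant
  set M' : ℝ≥0∞ := 2 * K + 2 * M with hM'_def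
  have hM't : M' ≠ ⊤ := by
    rw [hM'_def]
    exact ENNReal.add_ne_top.2 ⟨ENNReal.mul_ne_top (by norm_num) hKt,
      ENNReal.mul_ne_top (by norm_num) hM⟩
  have hKM' : K ≤ M' := by
    rw [hM'_def]
    calc K = 1 * K := (one_mul _).symm
      _ ≤ 2 * K := by gcongr; norm_num
      _ ≤ 2 * K + 2 * M := le_self_add
  have hMM' : M ≤ M' := by
    rw [hM'_def]
    calc M = 1 * M := (one_mul _).symm
      _ ≤ 2 * M := by gcongr; norm_num
      _ ≤ 2 * K + 2 * M := le_add_self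
  -- the force profile `F̄ + ¼ W·∇W` is bounded in `L²`
  have hFm : AEMeasurable (fun ξ => ‖steadyForceProfile Ubar ξ‖ₑ)
      (volume : Measure (EuclideanSpace ℝ (Fin 3))) := hFc.aemeasurable.enorm
  have hF2 : ∀ τ < τ₁, ∫⁻ ξ, ‖similarityResidual (Iio τ₁) (fun _ => Ubar) τ ξ +
      (4⁻¹ : ℝ) • convect (W τ) (W τ) ξ‖ₑ ^ 2 ≤ M' := by
    intro τ hτ
    have h4 : |(4⁻¹ : ℝ)| ≤ 1 := by norm_num
    have hWW' : ∫⁻ ξ, ‖(4⁻¹ : ℝ) • convect (W τ) (W τ) ξ‖ₑ ^ 2 ≤ M := by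
      refine le_trans (lintegral_mono fun ξ => ?_) (hWW τ hτ)
      gcongr
      rw [enorm_smul]
      calc ‖(4⁻¹ : ℝ)‖ₑ * ‖convect (W τ) (W τ) ξ‖ₑ ≤ 1 * ‖convect (W τ) (W τ) ξ‖ₑ := by
            gcongr
            rw [Real.enorm_eq_ofReal_abs]
            exact ENNReal.ofReal_le_one.2 h4
        _ = ‖convect (W τ) (W τ) ξ‖ₑ := one_mul _
    calc ∫⁻ ξ, ‖similarityResidual (Iio τ₁) (fun _ => Ubar) τ ξ +
          (4⁻¹ : ℝ) • convect (W τ) (W τ) ξ‖ₑ ^ 2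
        = ∫⁻ ξ, ‖steadyForceProfile Ubar ξ + (4⁻¹ : ℝ) • convect (W τ) (W τ) ξ‖ₑ ^ 2 :=
          lintegral_congr fun ξ => by rw [similarityResidual_const]
      _ ≤ (2 * ∫⁻ ξ, ‖steadyForceProfile Ubar ξ‖ₑ ^ 2) +
            2 * ∫⁻ ξ, ‖(4⁻¹ : ℝ) • convect (W τ) (W τ) ξ‖ₑ ^ 2 := lintegral_enorm_add_sq_le hFm _
      _ ≤ 2 * K + 2 * M := by gcongr
      _ = M' := by rw [hM'_def]
  exact albritton_brue_colombo_unit_of_linearizedSolution hU hW hQ (fun τ _ => hUdiv) hWdiv hlin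
    hM't (fun τ _ => hK1.trans hKM') (fun τ hτ => (hW2 τ hτ).trans hMM')
    (fun τ _ => hK2.trans hKM') (fun τ hτ => (hDW τ hτ).trans hMM')
    (fun τ _ => hK3.trans hKM') (fun τ hτ => (hW3 τ hτ).trans hMM')
    (fun τ hτ => (hQ2 τ hτ).trans hMM') hF2 hne

/-- **ns.S20 (`albritton_brue_colombo`, every viscosity) from Thm. 1.3 (a)-type data**, by
`albritton_brue_colombo_unit_of_linearizedMode` and the viscosity scaling
`albritton_brue_colombo_of_unit` (`NSLerayHopfABCScaling.lean`). [cite: AlbrittonBrueColombo2022, Thm. 1.3 (a) ⟹ Thm. 1.2] -/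
theorem albritton_brue_colombo_of_linearizedMode
    {Ubar : EuclideanSpace ℝ (Fin 3) → EuclideanSpace ℝ (Fin 3)} (hUs : ContDiff ℝ ∞ Ubar)
    (hUc : HasCompactSupport Ubar) (hUdiv : VectorCalculus.IsDivFree Ubar) {τ₁ : ℝ}
    {W : ℝ → EuclideanSpace ℝ (Fin 3) → EuclideanSpace ℝ (Fin 3)}
    {Q : ℝ → EuclideanSpace ℝ (Fin 3) → ℝ}
    (hW : IsSmoothSpaceTimeOn (Iio τ₁) W) (hQ : IsSmoothSpaceTimeOn (Iio τ₁) Q)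
    (hWdiv : ∀ τ < τ₁, VectorCalculus.IsDivFree (W τ))
    (hlin : ∀ τ < τ₁, ∀ ξ,
      linearizedResidual (Iio τ₁) (fun _ => Ubar) W τ ξ + gradient (Q τ) ξ = 0)
    {M : ℝ≥0∞} (hM : M ≠ ⊤) (hW2 : ∀ τ < τ₁, ∫⁻ ξ, ‖W τ ξ‖ₑ ^ 2 ≤ M)
    (hDW : ∀ τ < τ₁, ∫⁻ ξ, ENNReal.ofReal (frobeniusNormSq (fderiv ℝ (W τ) ξ)) ≤ M)
    (hW3 : ∀ τ < τ₁, ∫⁻ ξ, ‖W τ ξ‖ₑ ^ (3 : ℕ) ≤ M)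
    (hWW : ∀ τ < τ₁, ∫⁻ ξ, ‖convect (W τ) (W τ) ξ‖ₑ ^ 2 ≤ M)
    (hQ2 : ∀ τ < τ₁, ∫⁻ ξ, ‖Q τ ξ‖ₑ ^ 2 ≤ M)
    (hne : ∃ τ₀ < τ₁, ¬ (W τ₀ =ᵐ[volume] 0)) :
    albritton_brue_colombo :=
  albritton_brue_colombo_of_unit
    (albritton_brue_colombo_unit_of_linearizedMode hUs hUc hUdiv hW hQ hWdiv hlin hM hW2 hDW hW3
      hWW hQ2 hne)

end Final

end Literature.Analysis.FluidPDE

end
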